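import Literature.Probability.LatticeModels.RandomClusterEdgeWeights
import HarnessLib

/-!
# The homogeneous random-cluster measure is the edge-parameter measure with indicator weights (Grimmett 2006, (1.2) vs (1.20))

Topic `Literature/Probability/LatticeModels`. Grimmett 2006, eq. (1.20): "The measure `φ_{p,q}` is retrieved by setting `p_e = p`
for all `e ∈ E`." For the tree's two formalisations — `rcMeasure G p q B` (`RandomCluster.lean`, edge set `E(G)`, one parameter
`p`) and `rcMeasureW w q B` (`RandomClusterEdgeWeights.lean`, all of `Sym2 V` as edge set, parameters `w`) — this reads
`rcMeasure G p q B = rcMeasureW (edgeIndicatorWeights G p) q B` with the weights `p · 1_{E(G)}` (an edge outside `G` has parameter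
`0`, i.e. is almost surely closed): `rcMeasure_eq_rcMeasureW`. On the way: the point masses of `rcMeasureW`
(`rcMeasureW_real_singleton`), the product weight of indicator parameters (`weight_edgeIndicatorWeights`), and the equality of the
partition functions (`rcPartitionFunctionW_edgeIndicatorWeights`). Everything is proved.

## References

* G. Grimmett, *The Random-Cluster Model*, Springer 2006: §1.2 eq. (1.2), §1.4 eq. (1.20) (p. 15).
-/

noncomputable section

open MeasureTheory Finset
open scoped ENNReal Classical

namespace Literature.Probability.LatticeModels

open Literature.Probability.Percolation (BondConfig)
open Literature.Probability.Percolation.BHK2006 (weight weight_nonneg)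
open Literature.Probability.Percolation.DecisionTree (ind ind_of_mem ind_of_not_mem)

section Homogeneous

variable {V : Type*} (G : SimpleGraph V)

/-- The indicator parameters `p · 1_{E(G)}`: `p` on the edges of `G`, `0` elsewhere (Grimmett 2006, (1.20): "The measure `φ_{p,q}`
is retrieved by setting `p_e = p` for all `e ∈ E`"). [cite: Grimmett2006, §1.4 eq. (1.20) (p. 15)] -/
def edgeIndicatorWeights (p : unitInterval) : Sym2 V → unitInterval :=
  fun e => if e ∈ G.edgeSet then p else 0

/-- The indicator parameters as real numbers. [folklore] -/
private theorem coe_edgeIndicatorWeights (p : unitInterval) (e : Sym2 V) :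
    ((edgeIndicatorWeights G p e : unitInterval) : ℝ) = if e ∈ G.edgeSet then (p : ℝ) else 0 := by
  unfold edgeIndicatorWeights
  split_ifs <;> simp

variable [Fintype V]

/-- The point masses of `φ^B_{𝐩,q}`: `φ{a} = w(a)/Z`. [cite: Grimmett2006, §1.4 eq. (1.20) (p. 15)] -/
theorem rcMeasureW_real_singleton (w : Sym2 V → unitInterval) {q : ℝ} (hq : 0 < q) (B : Set V) (a : BondConfig V) :
    (rcMeasureW w q B).real {a} = rcWeightW w q B a / rcPartitionFunctionW w q B := by
  rw [rcMeasureW_real_eq_sum_div w hq B {a}, Finset.sum_eq_single a]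
  · rw [ind_of_mem (Set.mem_singleton a), mul_one]
  · intro b _ hb
    rw [ind_of_not_mem (fun h => hb (Set.mem_singleton_iff.1 h)), mul_zero]
  · intro h; exact (h (Finset.mem_univ a)).elim

variable [DecidableEq V] [DecidableRel G.Adj]

/-- **The product weight of the indicator parameters**: `∏_e (…) = p^{|ω|} (1-p)^{|E ∖ ω|}` for `ω ⊆ E(G)`, and `0` if `ω`
contains an edge outside `G`. [cite: Grimmett2006, §1.2 eq. (1.2); §1.4 eq. (1.20) (p. 15)] -/
theorem weight_edgeIndicatorWeights (p : unitInterval) (ω : Finset (Sym2 V)) :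
    weight (fun e => ((edgeIndicatorWeights G p e : unitInterval) : ℝ)) (↑ω : BondConfig V) =
      if ω ⊆ G.edgeFinset then (p : ℝ) ^ #ω * (1 - (p : ℝ)) ^ #(G.edgeFinset \ ω) else 0 := by
  unfold weight
  split_ifs with hω
  · -- every factor is `p` on `ω`, `1 - p` on `E ∖ ω`, `1` off `E`
    have hfac : ∀ e : Sym2 V,
        (if e ∈ (↑ω : BondConfig V) then ((edgeIndicatorWeights G p e : unitInterval) : ℝ)
          else 1 - ((edgeIndicatorWeights G p e : unitInterval) : ℝ)) =
        (if e ∈ ω then (p : ℝ) else 1) * (if e ∈ G.edgeFinset \ ω then 1 - (p : ℝ) else 1) := by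
      intro e
      rw [coe_edgeIndicatorWeights]
      have hE : e ∈ G.edgeFinset ↔ e ∈ G.edgeSet := SimpleGraph.mem_edgeFinset
      by_cases he : e ∈ ω
      · have heE : e ∈ G.edgeSet := hE.1 (hω he)
        simp [he, heE, Finset.mem_sdiff]
      · by_cases heE : e ∈ G.edgeSet
        · simp [he, heE, Finset.mem_sdiff, hE]
        · simp [he, heE, Finset.mem_sdiff, hE]
    simp_rw [hfac]
    rw [Finset.prod_mul_distrib, Finset.prod_ite_mem, Finset.prod_ite_mem, Finset.univ_inter, Finset.univ_inter,
      Finset.prod_const, Finset.prod_const]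
  · -- some edge of `ω` lies outside `G`: its factor is the parameter `0`
    obtain ⟨e, heω, heE⟩ : ∃ e ∈ ω, e ∉ G.edgeFinset := Finset.not_subset.1 hω
    refine Finset.prod_eq_zero (Finset.mem_univ e) ?_
    have heE' : e ∉ G.edgeSet := fun h => heE (SimpleGraph.mem_edgeFinset.2 h)
    rw [if_pos (show e ∈ (↑ω : BondConfig V) from Finset.mem_coe.2 heω)]
    simp only [coe_edgeIndicatorWeights, if_neg heE']

/-- The edge-parameter weight of the indicator parameters is the homogeneous weight on edge sets of `G` (extended by `0`).
[cite: Grimmett2006, §1.2 eq. (1.2); §1.4 eq. (1.20) (p. 15)] -/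
theorem rcWeightW_edgeIndicatorWeights (p : unitInterval) (q : ℝ) (B : Set V) (ω : Finset (Sym2 V)) :
    rcWeightW (edgeIndicatorWeights G p) q B (↑ω : BondConfig V) =
      if ω ⊆ G.edgeFinset then rcWeight G p q B ω else 0 := by
  unfold rcWeightW rcWeight
  rw [weight_edgeIndicatorWeights]
  split_ifs <;> simp

/-- Sums over all bond configurations (sets of edges of the complete edge set `Sym2 V`) of a function vanishing off the edge
sets of `G` are sums over the edge sets of `G`. [folklore] -/
private theorem sum_set_eq_sum_powerset (f : Finset (Sym2 V) → ℝ) :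
    ∑ S : BondConfig V, (if S.toFinset ⊆ G.edgeFinset then f S.toFinset else 0) =
      ∑ ω ∈ G.edgeFinset.powerset, f ω := by
  have h1 : ∑ S : BondConfig V, (if S.toFinset ⊆ G.edgeFinset then f S.toFinset else 0) =
      ∑ ω : Finset (Sym2 V), (if ω ⊆ G.edgeFinset then f ω else 0) := by
    refine Fintype.sum_equiv (Equiv.mk (fun S : BondConfig V => S.toFinset) (fun ω => (↑ω : BondConfig V))
      (fun S => by simp) (fun ω => by simp)) _ _ fun S => rfl
  have hfilter : (Finset.univ : Finset (Finset (Sym2 V))).filter (· ⊆ G.edgeFinset) = G.edgeFinset.powerset := by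
    ext ω; simp
  rw [h1, ← hfilter, Finset.sum_filter]

/-- **The partition functions agree**: `Z_{𝐩 = p·1_E, q} = Z^B_{G,p,q}`. [cite: Grimmett2006, §1.4 eq. (1.20) (p. 15)] -/
theorem rcPartitionFunctionW_edgeIndicatorWeights (p : unitInterval) (q : ℝ) (B : Set V) :
    rcPartitionFunctionW (edgeIndicatorWeights G p) q B = rcPartitionFunction G p q B := by
  rw [rcPartitionFunctionW, rcPartitionFunction, ← sum_set_eq_sum_powerset G (rcWeight G p q B)]
  refine Finset.sum_congr rfl fun S _ => ?_
  have h := rcWeightW_edgeIndicatorWeights G p q B S.toFinset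
  rw [Set.coe_toFinset] at h
  exact h

/-- **`φ^B_{G,p,q}` is `φ^B_{𝐩,q}` with `𝐩 = p · 1_{E(G)}`** (Grimmett 2006, (1.20): "The measure `φ_{p,q}` is retrieved by setting
`p_e = p` for all `e ∈ E`"; edges outside `G` get parameter `0`). For `0 < q`. [cite: Grimmett2006, §1.4 eq. (1.20) (p. 15)] -/
theorem rcMeasure_eq_rcMeasureW (p : unitInterval) {q : ℝ} (hq : 0 < q) (B : Set V) :
    rcMeasure G p q B = rcMeasureW (edgeIndicatorWeights G p) q B := by
  have hp : (p : ℝ) ∈ Set.Icc (0 : ℝ) 1 := p.2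
  haveI := isProbabilityMeasure_rcMeasure G hp hq B
  haveI := isProbabilityMeasure_rcMeasureW (edgeIndicatorWeights G p) hq B
  refine Measure.ext_of_singleton fun S => ?_
  rw [← ofReal_measureReal (measure_ne_top _ _), ← ofReal_measureReal (measure_ne_top _ _)]
  congr 1
  rw [rcMeasureW_real_singleton (edgeIndicatorWeights G p) hq B S, rcPartitionFunctionW_edgeIndicatorWeights,
    rcMeasure_real_apply G hp hq B {S}]
  have hW := rcWeightW_edgeIndicatorWeights G p q B S.toFinset
  rw [Set.coe_toFinset] at hW
  rw [hW]
  by_cases hS : S.toFinset ⊆ G.edgeFinset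
  · rw [if_pos hS, Finset.sum_eq_single_of_mem S.toFinset (Finset.mem_powerset.2 hS)]
    · rw [if_pos (show (↑S.toFinset : BondConfig V) ∈ ({S} : Set (BondConfig V)) by simp)]
    · intro ω _ hne
      rw [if_neg]
      intro h
      apply hne
      rw [Set.mem_singleton_iff] at h
      rw [← h, Finset.toFinset_coe]
  · rw [if_neg hS, zero_div]
    refine Finset.sum_eq_zero fun ω hω => ?_
    rw [if_neg]
    intro h
    rw [Set.mem_singleton_iff] at h
    apply hS
    rw [← h, Finset.toFinset_coe]
    exact Finset.mem_powerset.1 hω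

end Homogeneous

end Literature.Probability.LatticeModels

end
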